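import Mathlib
import Literature.MathematicalPhysics.QuantumFieldTheory.Balaban1983to89.B5Hk103ScalarZd
import Literature.MathematicalPhysics.QuantumFieldTheory.Balaban1983to89.B4Green242Bridge
import Literature.MathematicalPhysics.QuantumFieldTheory.Balaban1983to89.B5Momentum166Zd

/-!
# Bałaban [B6] (2.75) p.236, scalar, whole lattice `ℤ^d`: THE FOURIER REPRESENTATION OF `Q'_jG'_jQ'_j*` —
# `(Q'G'Q'*)(y, y′) = (2π)^{−d}∫_{[−π,π]^d} e^{ip′·(y−y′)} (Q'G'Q'*)~(p′) dp′` with the printed multiplier (2.75) —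
# the dictionary `G'Q'* = K` with the momentum kernel (2.48) of [B4], and the PRINTED ROUTE (2.75) + (2.50) ⇒ (2.76)

**Source (verbatim; the quotations LOCATE the statements — nothing printed is used as a hypothesis).**
[B6] = T. Bałaban, *Propagators and renormalization transformations for lattice gauge theories. II*, Commun. Math.
Phys. **96** (1984) 223–250 [`Balaban1984PropagatorsII`].  p. 236 [PDF 14] (render
`b2b-balaban-ref1/pages/1984-cmp96-propagators-rt-II/…-p014-x2.png`, read as an image by the author of this file):
«where we have used the Theorem of [3], G′_j denotes the operator (Δ^{L^{−j}} + a_jQ′_j*Q′_j)^{−1} on the whole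
lattice L^{−j}Z^d. In [3] an explicit representation of this operator was found and from this representation we get
the following Fourier representation of Q′_jG′_jQ′_j*:
(Q′_jG′_jQ′_j*)~(p′) = Σ_l |u_j(p′+l)|²Δ₀(p′)/Δ(p′+l) · (a_j Σ_l |u_j(p′+l)|²Δ₀(p′)/Δ(p′+l) + Δ₀(p′))^{−1}, (2.75)
p′ ∈ [−π, π]^d, l was described in (2.45) [3]. From this representation and the bounds (2.50), (2.51) of that paper
it follows that Q′_jG′_jQ′_j* ≥ 2γ₀; (2.76) γ₀ is a positive, absolute constant (a = 1).»  [3] = [B4] = T. Bałaban,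
*Regularity and decay of lattice Green's functions*, Commun. Math. Phys. **89** (1983) 571–597
[`Balaban1983RegularityDecay`], (2.44)–(2.48) p. 584–585 (quoted in `B4Green244`) and (2.50)–(2.51) p. 586 (quoted in
`B4Strip`).  The print ASSERTS (2.75) ("we get") and the inference to (2.76); neither is derived there.

**What is proved here (zero `sorry`; every `d`, every block side `n + 1 ≥ 1` (`= L^j`), every `a > 0`).**  Objects:
the pv23 scalar whole-lattice line — the site matrix `AX n a = Δ^η + aQ'*Q'` (`η = 1/(n+1)`, unit fine lattice, blocks
of side `n+1`), its B4-Sect.-5 inverse kernel `Gk n a = limInv ℤ^d (AX n a)` (= `G'_j`), `gq n a p y = Σ_{q∈B(y)} G'(p,q)`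
(= `G'Q'*`) and `kerQGQ n a y y′ = (n+1)^{−d}Σ_{p∈B(y)}(G'Q'*)(p,y′)` (= `Q'_jG'_jQ'_j*`, `B6QGQLower276`,
`B5Hk103ScalarZd`); and the torus-free momentum objects of `B4Green244` / `B4StripSums` / `B4Strip` — the Brillouin
zone `BZ d = [−π,π]^d`, `latticeKernel G x = (2π)^{−d}∫_{BZ} G(p′)e^{ip′·x}dp′`, the (2.48) kernel `K N a m² z y`, the
regrouped pole-free symbols `U_k = |u_j(p′+l)|²`, `R_k = Δ₀(p′)/Δ(p′+l)` (`R_0 = 1`), `E = Δ₀ + aΣ_k U_kR_k`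
(`l = 2πk`, `k ∈ (Fin N)^d` = the index set of (2.45)).
* §1 [folklore] the DICTIONARY of bookkeeping at `N = n + 1`: `coarse_succ` (`B4Green244.coarse (n+1) = blk n`),
  `finePt_succ` (`finePt (n+1) = chart n`), `sum_B_eq`, and the row action `rowAX` of `AX` = the real/imaginary parts of
  `B4Green244.opD (n+1) a 0` (`opD_re`, `opD_im`, `rowAX_eq`).
* §2 [folklore] **`eq_tsum_Gk_mul_rowAX` — bounded solutions of (2.44) on `ℤ^d` are represented by `G'`**:
  `φ = Σ'_z G'(·,z)(AXφ)(z)` for every bounded `φ` (Fubini against the exponential majorant of `Gk` × the finite-range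
  `AX`, `B5Hk103ScalarZd.tsum_mul_tsum_comm`, and `Σ'_z G'(p,z)AX(z,r) = δ_{pr}`); i.e. UNIQUENESS of bounded solutions.
* §3 **`K_eq_gq` — `G'_jQ'_j* = K`: the (2.48) kernel of [B4] at `m² = 0`, `N = n+1`, IS the pv23 kernel `gq`**
  [cite (2.48) p.585 via `B4Green244.green244`]: `K` is bounded (`norm_K_le`: `|K(z,y)| ≤ Σ_τ(2π)^{−d}∫|G(τ;p′)|dp′`,
  from `norm_latticeKernel_le`) and solves (2.44) with `f = Q'*δ_y` (`green244`), so §2 identifies `Re K = gq`,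
  `Im K = 0`.
* §4 **`symbQGQ` = the printed multiplier (2.75)** in the pole-free form `Σ_k U_kR_k/E` (`symbQGQ_eq_printed`: it is
  literally `Σ_l|u|²Δ₀/Δ(p′+l)·(aΣ_l|u|²Δ₀/Δ(p′+l) + Δ₀(p′))^{−1}`); `sum_Gfull_finePt` (`Q'` applied to the full
  multiplier of (2.48): `Σ_{z∈B(x)}Gfull(z;p′) = N^d e^{ip′·x}(2.75)(p′)` on the zone, from `B4Green244.blockAvg_PhZ_V`);
  and the MAIN THEOREM **`kerQGQ_eq_latticeKernel` — B6 (2.75) in kernel form on `ℤ^d`: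
  `(Q'_jG'_jQ'_j*)(y,y′) = (2π)^{−d}∫_{[−π,π]^d} e^{ip′·(y−y′)}(2.75)(p′)dp′`** for all `y, y′ ∈ ℤ^d`.
* §5 [(2.50) p.586; folklore] the multiplier on the real zone: it is REAL (`symbQGQ_ofReal`: `= symbR = X/(aX + Δ₀)`,
  `X = Σ_kU_kR_k`), `Xr_ge` (`X ≥ |u_j(p′)|² ≥ (4/π²)^d`, `B4Strip.Ur_zero_ge` = the O(1) of (2.50)), `DeltaXir_zero_le`
  (`Δ₀ ≤ dπ²`), hence **`symbR_ge`: `(2.75)(p′) ≥ 2γ₀ := (4/π²)^d/(a(4/π²)^d + dπ²)`** and `symbR_le` (`≤ 1/a`), uniformly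
  in `j`.
* §6 **`kerQGQ_eq_integral_cos`** ((2.75) in real form: `(Q'G'Q'*)(y,y′) = (2π)^{−d}∫(2.75)(p′)cos(p′·(y−y′))dp′`),
  **`qGqForm_eq_integral`** (`Σ_{y,y′}c(y)c(y′)(Q'G'Q'*)(y,y′) = (2π)^{−d}∫(2.75)(p′)|c̃(p′)|²dp′`, with node g9-1's
  `B5Momentum166Zd.FTsq` = `|c̃|²` and its Plancherel `integral_FTsq`), and **`qGq_lower_printed` — (2.76) BY THE
  PRINTED ROUTE: `2γ₀Σ_y c(y)² ≤ Σ_{y,y′}c(y)c(y′)(Q'G'Q'*)(y,y′)`** for every finitely supported `c`, every `j`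
  (companion `qGq_upper_printed`: `≤ (1/a)Σc²`).

RELATION TO THE TREE (by name).  `B6QGQLower276` (pv23 g7, HONEST SCOPE): «The Fourier representation (2.75), the
functions u_j, Δ₀, Δ, the index set of (2.45) [3] and the bounds (2.50), (2.51) of [3] are NOT formalised; (2.76) is
proved by a different (variational) argument, so this file certifies the printed STATEMENT (2.76) in the scalar case,
not the printed derivation» — this file formalises (2.75) for exactly that file's operator `kerQGQ` and types the
printed derivation (2.75) + (2.50) ⇒ (2.76), with an explicit `j`-independent constant (`twoGamma0 d a`; for `d = 4`,
`a = 1` about `6.8·10⁻⁴` against `gammaQ 4 1 = 1/(36⁴·17) ≈ 3.5·10⁻⁸`; the tree's `qGq_lower` keeps its own constant and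
is not touched).  `B4Green244` (beta-b4b) constructed the (2.48) kernel `K` and proved that it solves (2.44)
(`green244`) WITHOUT identifying it with an inverse operator; §2–§3 supply that identification on `ℤ^d` (`K = G'Q'*`,
`G'` = the B4 Sect. 5 inverse), which is the "explicit representation of this operator … found in [3]" of the quote.
`B5QGGQ145Torus` / `B5Bounds167Lattice` (pv15) and `Beta/*` (an5, b05) treat printed multipliers on TORI by finite
Fourier analysis — different objects, not imported.  Node g9-1 `B5Momentum166Zd` supplies `|c̃|²` and Plancherel on
the zone; `B4Green242Bridge` supplies `latticeKernel_const_mul`.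

HONEST SCOPE.  (i) SCALAR, `U = 1`, unit fine lattice (`η`-scaling absorbed as in the whole pv23 line: block side
`n + 1 = L^j`, `a = a_j` a free parameter `> 0`), `m² = 0`; (ii) WHOLE lattice `ℤ^d`: (2.75) is typed as the statement
that the KERNEL of `Q'G'Q'*` is the inverse Fourier integral over the closed zone `[−π,π]^d` (Lebesgue) of the printed
multiplier, read in the regrouped pole-free form `Σ_kU_kR_k/E` of `B4StripSums` (at `p′ = 0` the print's `l = 0` term
is `0/0`-free in this form: `R_0 = 1`); the multiplier is identified through the block sum of the (2.48) multiplier, not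
by summing the series `Σ_x(Q'G'Q'*)(x,0)e^{−ip′·x}` — that (Fourier-inversion) form of (2.75), the torus version, the
vector/covariant operators `G'_j(□̃)`, (2.74), (2.77), (2.78) are NOT touched; (iii) (2.51) of [3] is not needed on the
real zone at `m² = 0` beyond `E > 0` (`B4Green244.E_ne_zero_BZ`); the constant `2γ₀` is explicit but not claimed sharp,
and depends on `d` and `a` (print: absolute, `a = 1`); (iv) nothing here is summit progress: value = kernel discharge
of one printed representation and one printed inference in the scalar infinite-volume setting.

ABSOLUTE-RULE CENSUS: every theorem below is proved outright from the tree modules named above and Mathlib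
(sorry-free; axioms `propext`, `Classical.choice`, `Quot.sound` only); no quoted statement is used as a hypothesis;
the hypotheses of the headline theorems are `0 < a` only.  Unit `b2b-balaban-pv23-g9` (surge node prover #23, gen 9;
journal claim B6-275-QGQ-FOURIER-ZD); value = kernel discharge (scalar, infinite volume), NOT summit progress.
-/

namespace Literature.MathematicalPhysics.QuantumFieldTheory.Balaban1983to89.B6QGQFourier275Zd

open Finset MeasureTheory Complex
open B6QGQLower276 B6QGQDecay237 B5Hk103ScalarZd
open B4Strip (ofRealVec U E DeltaXi Ur Er DeltaXir shiftr Sxir U_ofReal E_ofReal DeltaXi_ofReal shift_ofReal Ur_nonneg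
  Ur_zero_ge DeltaXir_nonneg Sxir_le)
open B5Ineq167SymbolZd (phase phase_zero)
open B5Momentum166Zd (FTsq FTsq_nonneg integral_FTsq continuous_FTsq phaseC_eq continuous_phase continuous_cos_phase
  isCompact_BZ measurableSet_BZ integrableOn_BZ)
open B4StripCauchy (Fat)
open B4ContourShift (BZ latticeKernel fourierBox integrand continuous_ofRealVec norm_cexp_phase)
open B4Green242Bridge (latticeKernel_const_mul)
open B4StripSums (G term R differentiableAt_G)
open B4StripSumsHolder (PhZ)
open B4Green244 (coarse offset finePt finePt_coarse_offset coarse_finePt Gfull Gfull_finePt K_eq green244 opD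
  negLap blockAvg blockAvg_PhZ_V E_eq_sum_R E_ne_zero_BZ differentiableAt_Gfull latticeKernel_phase_mul
  latticeKernel_congr latticeKernel_sum_mul integrableOn_of_differentiableAt ofRealVec_mem_Fat phaseC V)
open scoped Real

noncomputable section

variable {d : ℕ}

/-! ## §1  Dictionary between the fine-lattice bookkeeping of `B4Green244` (parameter `N = n+1`) and of the pv23 line -/

/-- the block side of `B4Green244` (`N = n+1 : ℕ`) cast to `ℤ` is `side n`. [folklore] -/
theorem natCast_succ_eq_side (n : ℕ) : ((n + 1 : ℕ) : ℤ) = side n := by unfold side; push_cast; ring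

/-- the coarse map of `B4Green244` at `N = n+1` is the block map `blk n` of the pv23 line. [folklore] -/
theorem coarse_succ (n : ℕ) (z : X d) : coarse (n + 1) z = blk n z := by
  funext ν; simp only [coarse, blk, natCast_succ_eq_side]

/-- the fine points of a block: `finePt (n+1) = chart n`. [folklore] -/
theorem finePt_succ (n : ℕ) (x : X d) (j : Fin d → Fin (n + 1)) : finePt (n + 1) x j = chart n x j := by
  funext ν; simp only [finePt, chart, natCast_succ_eq_side]

/-- a sum over the block `B(y)` is a sum over the chart `(Fin (n+1))^d`. [folklore] -/
theorem sum_B_eq {M : Type*} [AddCommMonoid M] (n : ℕ) (y : X d) (f : X d → M) :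
    ∑ p ∈ B n y, f p = ∑ z : Fin d → Fin (n + 1), f (chart n y z) :=
  Finset.sum_image fun _ _ _ _ h => (chart_inj h).2

/-- the two unit-vector conventions agree. [folklore] -/
theorem e_eq (μ : Fin d) : B4Green244.e μ = e μ := rfl

/-- the row action `(AXφ)(z) = Σ'_r AX(z,r)φ(r)` of the site matrix `Δ^η + aQ'*Q'`. [folklore] -/
def rowAX (n : ℕ) (a : ℝ) (φ : X d → ℝ) (z : X d) : ℝ := ∑' r : X d, AX n a z r * φ r

/-- the `Q'*Q'` part of a row of `AX` acts as the block sum. [folklore] -/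
theorem sum_nbhd_sameBlk_mul (n : ℕ) (z : X d) (φ : X d → ℝ) :
    ∑ r ∈ nbhd n z, sameBlk n z r * φ r = ∑ r ∈ B n (blk n z), φ r := by
  classical
  have hsub : B n (blk n z) ⊆ nbhd n z := fun r hr =>
    Finset.mem_union_left _ (Finset.mem_union_left _ hr)
  rw [← Finset.sum_subset hsub (fun r _ hr => by
    have : blk n z ≠ blk n r := fun h => hr (mem_B.2 h.symm)
    simp [sameBlk, this])]
  refine Finset.sum_congr rfl fun r hr => ?_
  have : blk n z = blk n r := (mem_B.1 hr).symm
  simp [sameBlk, this]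

/-- the row action of `AX = Δ^η + aQ'*Q'` explicitly: second differences plus `a(n+1)^{−d}` × block sum. [folklore] -/
theorem rowAX_eq (n : ℕ) (a : ℝ) (φ : X d → ℝ) (z : X d) :
    rowAX n a φ z = ((n : ℝ) + 1) ^ 2 * ∑ μ, (2 * φ z - φ (z + e μ) - φ (z - e μ))
      + a / ((n : ℝ) + 1) ^ d * ∑ r ∈ B n (blk n z), φ r := by
  unfold rowAX
  rw [tsum_AX_mul]
  have h1 : ∑ r ∈ nbhd n z, AX n a z r * φ r
      = ((n : ℝ) + 1) ^ 2 * ∑ r ∈ nbhd n z, lapKer z r * φ r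
        + a / ((n : ℝ) + 1) ^ d * ∑ r ∈ nbhd n z, sameBlk n z r * φ r := by
    simp only [AX, add_mul, Finset.sum_add_distrib, Finset.mul_sum, mul_assoc]
  rw [h1, sum_nbhd_sameBlk_mul, ← tsum_lapKer_mul z φ,
    tsum_eq_sum (s := nbhd n z) (fun r hr => by rw [lapKer_eq_zero_of_not_mem (n := n) hr, zero_mul])]

/-- the real part of `B4Green244.opD (n+1) a 0 ψ` is the row action of `AX n a` on `Re ψ`. [folklore] -/
theorem opD_re (n : ℕ) (a : ℝ) (ψ : X d → ℂ) (z : X d) :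
    (opD (n + 1) a 0 ψ z).re = rowAX n a (fun r => (ψ r).re) z := by
  rw [rowAX_eq]
  unfold opD negLap blockAvg
  rw [coarse_succ]
  simp only [finePt_succ, e_eq]
  rw [← sum_B_eq n (blk n z) ψ]
  have h1 : ((n + 1 : ℕ) : ℂ) ^ 2 = ((((n : ℝ) + 1) ^ 2 : ℝ) : ℂ) := by push_cast; ring
  have h2 : (((n + 1 : ℕ) : ℂ) ^ d)⁻¹ = (((((n : ℝ) + 1) ^ d)⁻¹ : ℝ) : ℂ) := by push_cast; ring
  rw [h1, h2]
  simp only [Complex.add_re, Complex.re_ofReal_mul, Complex.re_sum, Complex.sub_re, Complex.ofReal_zero,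
    zero_mul, add_zero]
  congr 1
  · congr 1
    refine Finset.sum_congr rfl fun μ _ => ?_
    simp [Complex.mul_re]
  · rw [div_eq_mul_inv, mul_assoc]

/-- the imaginary part of `B4Green244.opD (n+1) a 0 ψ` is the row action of `AX n a` on `Im ψ`. [folklore] -/
theorem opD_im (n : ℕ) (a : ℝ) (ψ : X d → ℂ) (z : X d) :
    (opD (n + 1) a 0 ψ z).im = rowAX n a (fun r => (ψ r).im) z := by
  rw [rowAX_eq]
  unfold opD negLap blockAvg
  rw [coarse_succ]
  simp only [finePt_succ, e_eq]
  rw [← sum_B_eq n (blk n z) ψ]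
  have h1 : ((n + 1 : ℕ) : ℂ) ^ 2 = ((((n : ℝ) + 1) ^ 2 : ℝ) : ℂ) := by push_cast; ring
  have h2 : (((n + 1 : ℕ) : ℂ) ^ d)⁻¹ = (((((n : ℝ) + 1) ^ d)⁻¹ : ℝ) : ℂ) := by push_cast; ring
  rw [h1, h2]
  simp only [Complex.add_im, Complex.im_ofReal_mul, Complex.im_sum, Complex.sub_im, Complex.ofReal_zero,
    zero_mul, add_zero]
  congr 1
  · congr 1
    refine Finset.sum_congr rfl fun μ _ => ?_
    simp [Complex.mul_im]
  · rw [div_eq_mul_inv, mul_assoc]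

/-! ## §2  Uniqueness of bounded solutions of the basic equation on `ℤ^d` -/

/-- **Bounded solutions of (2.44) on `ℤ^d` are represented by `G'`**: `φ(p) = Σ'_z G'(p,z)(AXφ)(z)` for every bounded
`φ : ℤ^d → ℝ` — Fubini against the exponential majorant of `G'` and `Σ'_z G'(p,z)AX(z,r) = δ_{pr}`; in particular a
bounded solution of `AXφ = f` is unique. [folklore] -/
theorem eq_tsum_Gk_mul_rowAX (n : ℕ) {a : ℝ} (ha : 0 < a) {φ : X d → ℝ} {M : ℝ} (hφ : ∀ r, |φ r| ≤ M)
    (p : X d) : φ p = ∑' z : X d, Gk n a p z * rowAX n a φ z := by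
  have hM : 0 ≤ M := (abs_nonneg _).trans (hφ p)
  have hα : 0 < deltaU d a / ((n : ℝ) + 1) := div_pos (deltaU_pos d ha) (by positivity)
  have h0 : 0 < 2 / min 2 a := div_pos two_pos (lt_min two_pos ha)
  have hc0 : 0 ≤ c0 d n a := (c0_pos d n ha.ne').le
  have hswap := tsum_mul_tsum_comm (f := fun z => Gk n a p z) (g := fun z r => AX n a z r * φ r)
    (C := 2 / min 2 a * c0 d n a * M) hα one_pos p (fun z r => by
      rw [abs_mul, abs_mul]
      have h1 := abs_Gk_le n ha p z
      have h2 := abs_AX_le n a z r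
      have h3 := hφ r
      have e1 : Real.exp (-(deltaU d a * (dist p z / ((n : ℝ) + 1))))
          = Real.exp (-(deltaU d a / ((n : ℝ) + 1) * dist p z)) := by congr 1; ring
      rw [e1] at h1
      calc |Gk n a p z| * (|AX n a z r| * |φ r|)
          ≤ (2 / min 2 a * Real.exp (-(deltaU d a / ((n : ℝ) + 1) * dist p z)))
              * ((c0 d n a * Real.exp (-(1 * dist z r))) * M) :=
            mul_le_mul h1 (mul_le_mul h2 h3 (abs_nonneg _) (by positivity)) (by positivity) (by positivity)
        _ = 2 / min 2 a * c0 d n a * M * Real.exp (-(deltaU d a / ((n : ℝ) + 1) * dist p z))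
              * Real.exp (-(1 * dist z r)) := by ring)
  unfold rowAX
  rw [hswap]
  have hinner : ∀ r : X d, ∑' z : X d, Gk n a p z * (AX n a z r * φ r) = (if p = r then 1 else 0) * φ r := by
    intro r
    simp_rw [← mul_assoc]
    rw [tsum_mul_right, tsum_Gk_mul_AX n ha]
  simp_rw [hinner]
  rw [tsum_eq_single p (fun r hr => by rw [if_neg (Ne.symm hr), zero_mul]), if_pos rfl, one_mul]

/-! ## §3  The (2.48) kernel of `B4Green244` is bounded, hence it IS `G'Q'*` of the pv23 line -/

/-- `|K(x)| ≤ (2π)^{-d} ∫ |G(p)| dp` for the lattice kernel of a multiplier `G`. [folklore] -/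
theorem norm_latticeKernel_le (Gm : (Fin d → ℂ) → ℂ) (x : X d) :
    ‖latticeKernel Gm x‖ ≤ ((2 * π) ^ d)⁻¹ * ∫ p in BZ d, ‖Gm (ofRealVec p)‖ := by
  unfold latticeKernel fourierBox
  rw [norm_smul, Real.norm_eq_abs, abs_of_pos (by positivity)]
  refine mul_le_mul_of_nonneg_left ?_ (by positivity)
  calc ‖∫ p in BZ d, integrand Gm x p‖ ≤ ∫ p in BZ d, ‖integrand Gm x p‖ := norm_integral_le_integral_norm _
    _ = ∫ p in BZ d, ‖Gm (ofRealVec p)‖ := by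
        congr 1
        funext p
        unfold integrand
        rw [norm_mul, norm_cexp_phase, mul_one]

/-- the `L¹`-size of the block-offset multiplier `G(τ; ·)` of (2.48) at `m² = 0` on the zone. [folklore] -/
def Mtau (N : ℕ) [NeZero N] (a : ℝ) (τ : Fin d → Fin N) : ℝ := ((2 * π) ^ d)⁻¹ * ∫ p in BZ d, ‖G N a 0 τ (ofRealVec p)‖

/-- a bound for the (2.48) kernel uniform in the fine point: the sum over all offsets. [folklore] -/
def MK (N : ℕ) [NeZero N] (a : ℝ) : ℝ := ∑ τ : Fin d → Fin N, Mtau N a τ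

/-- `Mtau ≥ 0`. [folklore] -/
theorem Mtau_nonneg (N : ℕ) [NeZero N] (a : ℝ) (τ : Fin d → Fin N) : 0 ≤ Mtau (d := d) N a τ := by
  unfold Mtau
  exact mul_nonneg (by positivity) (integral_nonneg fun p => norm_nonneg _)

/-- **the (2.48) kernel is bounded on the fine lattice**: `|K(z, y)| ≤ M_K` for all `z, y`. [folklore] -/
theorem norm_K_le (N : ℕ) [NeZero N] (a : ℝ) (z y : X d) :
    ‖B4Green244.K N a 0 z y‖ ≤ MK (d := d) N a := by
  unfold B4Green244.K MK
  refine (norm_latticeKernel_le _ _).trans ?_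
  exact Finset.single_le_sum (f := fun τ => Mtau N a τ) (fun τ _ => Mtau_nonneg N a τ) (Finset.mem_univ (offset N z))

/-- the right side of (2.44) for `f = Q^*δ_y`, read in the pv23 bookkeeping: `1_{B(y)}(z) = 1[blk z = y]`. [folklore] -/
theorem green244_succ (n : ℕ) {a : ℝ} (ha : 0 < a) (z y : X d) :
    opD (n + 1) a 0 (fun z' => B4Green244.K (n + 1) a 0 z' y) z = if blk n z = y then 1 else 0 := by
  rw [green244 (n + 1) (by omega) a 0 ha le_rfl z y, coarse_succ]

/-- the series `Σ'_z G'(p,z)·1[blk z = y]` is the block sum `(G'Q'*)(p, y)`. [folklore] -/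
theorem tsum_Gk_mul_indicator (n : ℕ) (a : ℝ) (p y : X d) :
    ∑' z : X d, Gk n a p z * (if blk n z = y then (1 : ℝ) else 0) = gq n a p y := by
  classical
  rw [tsum_eq_sum (s := B n y) (fun z hz => by rw [if_neg (fun h => hz (mem_B.2 h)), mul_zero])]
  unfold gq
  exact Finset.sum_congr rfl fun z hz => by rw [if_pos (mem_B.1 hz), mul_one]

/-- **`Re K = G'Q'*`**: the real part of the (2.48) kernel (`N = n+1`, `m² = 0`) is the pv23 kernel `gq`. [folklore] -/
theorem K_re_eq_gq (n : ℕ) {a : ℝ} (ha : 0 < a) (z y : X d) : (B4Green244.K (n + 1) a 0 z y).re = gq n a z y := by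
  have hb : ∀ r : X d, |(B4Green244.K (n + 1) a 0 r y).re| ≤ MK (d := d) (n + 1) a := fun r =>
    (Complex.abs_re_le_norm _).trans (norm_K_le (n + 1) a r y)
  have h := eq_tsum_Gk_mul_rowAX n ha hb z
  have hrow : ∀ r : X d, rowAX n a (fun r' => (B4Green244.K (n + 1) a 0 r' y).re) r
      = if blk n r = y then (1 : ℝ) else 0 := by
    intro r
    rw [← opD_re, green244_succ n ha]
    split_ifs <;> simp
  simp_rw [hrow] at h
  rw [h, tsum_Gk_mul_indicator]

/-- **`Im K = 0`**: the (2.48) kernel is real. [folklore] -/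
theorem K_im_eq_zero (n : ℕ) {a : ℝ} (ha : 0 < a) (z y : X d) : (B4Green244.K (n + 1) a 0 z y).im = 0 := by
  have hb : ∀ r : X d, |(B4Green244.K (n + 1) a 0 r y).im| ≤ MK (d := d) (n + 1) a := fun r =>
    (Complex.abs_im_le_norm _).trans (norm_K_le (n + 1) a r y)
  have h := eq_tsum_Gk_mul_rowAX n ha hb z
  have hrow : ∀ r : X d, rowAX n a (fun r' => (B4Green244.K (n + 1) a 0 r' y).im) r = 0 := by
    intro r
    rw [← opD_im, green244_succ n ha]
    split_ifs <;> simp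
  simp_rw [hrow, mul_zero, tsum_zero] at h
  exact h

/-- **THE DICTIONARY THEOREM `G'Q'* = K`**: the kernel `(G'Q'*)(z, y) = Σ_{q ∈ B(y)} G'(z, q)` of the pv23 line
(`G'` = the B4 Sect. 5 inverse kernel `limInv` of the site matrix `Δ^η + aQ'*Q'`, `η = 1/(n+1)`) IS the momentum kernel
(2.48) of [3] = B4 at `m² = 0` — the «explicit representation of this operator … found in [3]» of p. 236.
[cite: Balaban1983RegularityDecay, (2.48) p.585] -/
theorem K_eq_gq (n : ℕ) {a : ℝ} (ha : 0 < a) (z y : X d) : B4Green244.K (n + 1) a 0 z y = (gq n a z y : ℂ) := by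
  apply Complex.ext
  · rw [K_re_eq_gq n ha, Complex.ofReal_re]
  · rw [K_im_eq_zero n ha, Complex.ofReal_im]

/-! ## §4  B6 (2.75): the Fourier representation of `Q'G'Q'*` on the whole unit lattice -/

/-- **THE PRINTED MULTIPLIER (2.75)** (regrouped, pole-free form of `B4StripSums`):
`(Q'_jG'_jQ'_j*)~(p′) = Σ_k U_k(p′) R_k(p′) / E(p′)`, `U_k = |u_j(p′+l)|²`, `R_k = Δ₀(p′)/Δ(p′+l)` (`l = 2πk`),
`E = a Σ_k U_k R_k + Δ₀(p′)` (`symbQGQ_eq_printed`). [cite: Balaban1984PropagatorsII, (2.75) p.236] -/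
def symbQGQ (N : ℕ) [NeZero N] (a : ℝ) (P : Fin d → ℂ) : ℂ :=
  ∑ k : Fin d → Fin N, U N k P * R N 0 k P / E N a 0 P

/-- `symbQGQ` is literally the right side of (2.75): `Σ_l |u|²Δ₀/Δ(p′+l) · (a Σ_l |u|²Δ₀/Δ(p′+l) + Δ₀(p′))⁻¹`.
[cite: Balaban1984PropagatorsII, (2.75) p.236] -/
theorem symbQGQ_eq_printed (N : ℕ) [NeZero N] (a : ℝ) (P : Fin d → ℂ) :
    symbQGQ N a P = (∑ k : Fin d → Fin N, U N k P * R N 0 k P)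
      * (a * ∑ k : Fin d → Fin N, U N k P * R N 0 k P + DeltaXi N 0 P)⁻¹ := by
  unfold symbQGQ
  rw [E_eq_sum_R, ← Finset.sum_div, div_eq_mul_inv, add_comm]

/-- **`Q'` applied to the full multiplier**: the sum of `Gfull(z; p′)` over the fine points `z` of the block `B(x)` is
`N^d e^{ip′·x} · (2.75)(p′)` on the real zone (`blockAvg_PhZ_V` fibre by fibre). [cite: Balaban1984PropagatorsII, (2.75) p.236] -/
theorem sum_Gfull_finePt (N : ℕ) [NeZero N] (hN : 1 ≤ N) (a : ℝ) (x : X d) (p : Fin d → ℝ) (hp : p ∈ BZ d) :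
    ∑ j : Fin d → Fin N, Gfull N a 0 (finePt N x j) (ofRealVec p)
      = (N : ℂ) ^ d * (cexp (I * phaseC (ofRealVec p) x) * symbQGQ N a (ofRealVec p)) := by
  unfold Gfull symbQGQ
  rw [Finset.sum_comm, Finset.mul_sum, Finset.mul_sum]
  refine Finset.sum_congr rfl fun k _ => ?_
  have hN0 : ((N : ℂ) ^ d) ≠ 0 := pow_ne_zero _ (Nat.cast_ne_zero.mpr (NeZero.ne N))
  have h' : ∑ j : Fin d → Fin N, PhZ N k (finePt N x j) (ofRealVec p) * V N k (ofRealVec p)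
      = (N : ℂ) ^ d * (cexp (I * phaseC (ofRealVec p) x) * U N k (ofRealVec p)) := by
    rw [← blockAvg_PhZ_V N hN k x p hp, ← mul_assoc, mul_inv_cancel₀ hN0, one_mul]
  have h2 : ∑ j : Fin d → Fin N, PhZ N k (finePt N x j) (ofRealVec p) * V N k (ofRealVec p)
        * R N 0 k (ofRealVec p) / E N a 0 (ofRealVec p)
      = (∑ j : Fin d → Fin N, PhZ N k (finePt N x j) (ofRealVec p) * V N k (ofRealVec p))
        * (R N 0 k (ofRealVec p) / E N a 0 (ofRealVec p)) := by
    rw [Finset.sum_mul]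
    exact Finset.sum_congr rfl fun j _ => by ring
  rw [h2, h']
  ring

/-- `(Q'G'Q'*)(y, y') = (n+1)^{−d} Σ_{p ∈ B(y)} (G'Q'*)(p, y')` — the definition, regrouped. [folklore] -/
theorem kerQGQ_eq_sum_gq (n : ℕ) (a : ℝ) (y y' : X d) :
    kerQGQ n a y y' = (((n : ℝ) + 1) ^ d)⁻¹ * ∑ p ∈ B n y, gq n a p y' := rfl

/-- **B6 (2.75), KERNEL FORM, scalar case on the whole unit lattice `ℤ^d`.**  For every `n` (block side `n+1 = L^j`,
`η = ξ = 1/(n+1)`), every `a > 0` and all `y, y' ∈ ℤ^d`: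
`(Q'_jG'_jQ'_j*)(y, y') = (2π)^{−d} ∫_{[−π,π]^d} e^{ip′·(y−y′)} (Q'_jG'_jQ'_j*)~(p′) dp′`
with `(Q'_jG'_jQ'_j*)~ = symbQGQ (n+1) a` the printed multiplier (2.75) — where `Q'G'Q'*` is the pv23 kernel
`B6QGQLower276.kerQGQ` built from the B4 Sect. 5 inverse `G' = (Δ^η + aQ'*Q')⁻¹ = limInv ℤ^d (AX n a)`.
Print (p. 236): «G′_j denotes the operator (Δ^{L^{−j}} + a_jQ′_j*Q′_j)^{−1} on the whole lattice L^{−j}Z^d. In [3] an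
explicit representation of this operator was found and from this representation we get the following Fourier
representation of Q′_jG′_jQ′_j*: (2.75)».  [cite: Balaban1984PropagatorsII, (2.75) p.236] -/
theorem kerQGQ_eq_latticeKernel (n : ℕ) {a : ℝ} (ha : 0 < a) (y y' : X d) :
    (kerQGQ n a y y' : ℂ) = latticeKernel (symbQGQ (n + 1) a) (y - y') := by
  have hN : 1 ≤ n + 1 := by omega
  have hN0 : (((n + 1 : ℕ) : ℂ) ^ d) ≠ 0 := pow_ne_zero _ (Nat.cast_ne_zero.mpr (Nat.succ_ne_zero n))
  -- the block sum of the (2.48) kernels is the kernel of the block-summed multiplier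
  have hint : ∀ j ∈ (Finset.univ : Finset (Fin d → Fin (n + 1))),
      IntegrableOn (integrand (Gfull (n + 1) a 0 (finePt (n + 1) y j)) (-y')) (BZ d) := fun j _ =>
    integrableOn_of_differentiableAt (fun p hp => differentiableAt_Gfull (n + 1) hN a 0 ha le_rfl _ p hp) (-y')
  have hsum : ∑ j : Fin d → Fin (n + 1), latticeKernel (Gfull (n + 1) a 0 (finePt (n + 1) y j)) (-y')
      = latticeKernel (fun P => ∑ j : Fin d → Fin (n + 1), Gfull (n + 1) a 0 (finePt (n + 1) y j) P) (-y') := by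
    have h := latticeKernel_sum_mul Finset.univ (fun _ => (1 : ℂ))
      (fun j => Gfull (n + 1) a 0 (finePt (n + 1) y j)) (-y') hint
    simp only [one_mul] at h
    exact h.symm
  calc (kerQGQ n a y y' : ℂ)
      = (((n + 1 : ℕ) : ℂ) ^ d)⁻¹ * ∑ j : Fin d → Fin (n + 1), B4Green244.K (n + 1) a 0 (chart n y j) y' := by
        rw [kerQGQ_eq_sum_gq, sum_B_eq]
        push_cast
        simp_rw [K_eq_gq n ha]
    _ = (((n + 1 : ℕ) : ℂ) ^ d)⁻¹
          * latticeKernel (fun P => ∑ j : Fin d → Fin (n + 1), Gfull (n + 1) a 0 (finePt (n + 1) y j) P) (-y') := by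
        simp_rw [← finePt_succ, K_eq]
        rw [hsum]
    _ = latticeKernel (fun P => (((n + 1 : ℕ) : ℂ) ^ d)⁻¹
          * ∑ j : Fin d → Fin (n + 1), Gfull (n + 1) a 0 (finePt (n + 1) y j) P) (-y') :=
        (latticeKernel_const_mul _ _ _).symm
    _ = latticeKernel (fun P => cexp (I * phaseC P y) * symbQGQ (n + 1) a P) (-y') := by
        refine latticeKernel_congr (fun p hp => ?_) (-y')
        rw [sum_Gfull_finePt (n + 1) hN a y p hp, ← mul_assoc, inv_mul_cancel₀ hN0, one_mul]
    _ = latticeKernel (symbQGQ (n + 1) a) (y - y') := by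
        rw [latticeKernel_phase_mul, neg_add_eq_sub]

/-! ## §5  The multiplier on the real zone: it is real, and the printed bounds (2.50)–(2.51) give `2γ₀ ≤ (2.75) ≤ 1/a` -/

/-- the regrouping ratio `R_k = Δ₀(p′)/Δ(p′+l)` (`R_0 = 1`) on real momenta. [folklore] -/
def Rr (N : ℕ) [NeZero N] (k : Fin d → Fin N) (s : Fin d → ℝ) : ℝ :=
  if k = fun _ => (0 : Fin N) then 1 else DeltaXir N 0 s / DeltaXir N 0 (shiftr N k s)

/-- `R_k` is real on real momenta. [folklore] -/
theorem R_ofReal (N : ℕ) [NeZero N] (k : Fin d → Fin N) (s : Fin d → ℝ) :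
    R N 0 k (ofRealVec s) = ((Rr N k s : ℝ) : ℂ) := by
  unfold R Rr
  split_ifs with h
  · simp
  · rw [shift_ofReal, DeltaXi_ofReal, DeltaXi_ofReal]
    push_cast
    rfl

/-- `R_k ≥ 0` on real momenta (`m² = 0`). [folklore] -/
theorem Rr_nonneg (N : ℕ) [NeZero N] (k : Fin d → Fin N) (s : Fin d → ℝ) : 0 ≤ Rr N k s := by
  unfold Rr
  split_ifs
  · norm_num
  · exact div_nonneg (DeltaXir_nonneg N 0 le_rfl s) (DeltaXir_nonneg N 0 le_rfl _)

/-- `X(p′) = Σ_l |u_j(p′+l)|² Δ₀(p′)/Δ(p′+l)` — the numerator of (2.75) on real momenta. [folklore] -/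
def Xr (N : ℕ) [NeZero N] (s : Fin d → ℝ) : ℝ := ∑ k : Fin d → Fin N, Ur N k s * Rr N k s

/-- `X ≥ 0`. [folklore] -/
theorem Xr_nonneg (N : ℕ) [NeZero N] (s : Fin d → ℝ) : 0 ≤ Xr N s :=
  Finset.sum_nonneg fun _ _ => mul_nonneg (Ur_nonneg _ _ _) (Rr_nonneg _ _ _)

/-- **(2.50) for the numerator**: `X(p′) ≥ |u_j(p′)|² ≥ (4/π²)^d` on the zone. [cite: Balaban1983RegularityDecay, (2.50) p.586] -/
theorem Xr_ge (N : ℕ) [NeZero N] (hN : 1 ≤ N) (s : Fin d → ℝ) (hs : ∀ μ, |s μ| ≤ π) :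
    (4 / π ^ 2) ^ d ≤ Xr N s := by
  unfold Xr
  calc (4 / π ^ 2) ^ d ≤ Ur N (fun _ => 0) s := Ur_zero_ge N hN s hs
    _ = Ur N (fun _ => 0) s * Rr N (fun _ => 0) s := by simp [Rr]
    _ ≤ ∑ k : Fin d → Fin N, Ur N k s * Rr N k s :=
        Finset.single_le_sum (f := fun k => Ur N k s * Rr N k s)
          (fun k _ => mul_nonneg (Ur_nonneg _ _ _) (Rr_nonneg _ _ _)) (Finset.mem_univ _)

/-- `Δ₀(p′) = Δ^ξ(p′) ≤ |p′|² ≤ dπ²` on the zone. [folklore] -/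
theorem DeltaXir_zero_le (N : ℕ) (s : Fin d → ℝ) (hs : ∀ μ, |s μ| ≤ π) : DeltaXir N 0 s ≤ d * π ^ 2 := by
  unfold DeltaXir
  rw [add_zero]
  calc ∑ μ, Sxir N (s μ) ≤ ∑ _μ : Fin d, π ^ 2 := Finset.sum_le_sum fun μ _ => (Sxir_le N (s μ)).trans (by
          have h := hs μ
          rw [abs_le] at h
          nlinarith [Real.pi_pos])
    _ = d * π ^ 2 := by simp

/-- **THE PRINTED MULTIPLIER ON THE REAL ZONE, as a real number**: `X(p′)/(aX(p′) + Δ₀(p′))`. [cite: Balaban1984PropagatorsII, (2.75) p.236] -/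
def symbR (N : ℕ) [NeZero N] (a : ℝ) (s : Fin d → ℝ) : ℝ := Xr N s / (a * Xr N s + DeltaXir N 0 s)

/-- the regrouped denominator on real momenta is `aX + Δ₀`. [folklore] -/
theorem Er_eq (N : ℕ) [NeZero N] (a : ℝ) (s : Fin d → ℝ) : Er N a 0 s = a * Xr N s + DeltaXir N 0 s := by
  apply Complex.ofReal_injective
  rw [← E_ofReal, E_eq_sum_R]
  unfold Xr
  push_cast
  simp_rw [U_ofReal, R_ofReal, DeltaXi_ofReal]
  ring

/-- **(2.75) is real on the zone**: `symbQGQ(p′) = symbR(p′)` for real `p′`. [folklore] -/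
theorem symbQGQ_ofReal (N : ℕ) [NeZero N] (a : ℝ) (s : Fin d → ℝ) :
    symbQGQ N a (ofRealVec s) = ((symbR N a s : ℝ) : ℂ) := by
  unfold symbQGQ symbR
  rw [← Finset.sum_div, E_ofReal, Er_eq]
  unfold Xr
  push_cast
  simp_rw [U_ofReal, R_ofReal]

/-- the constant `2γ₀ = (4/π²)^d / (a(4/π²)^d + dπ²)` of (2.76), explicit and independent of `j`. [folklore] -/
def twoGamma0 (d : ℕ) (a : ℝ) : ℝ := (4 / π ^ 2) ^ d / (a * (4 / π ^ 2) ^ d + d * π ^ 2)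

/-- `2γ₀ > 0`. [folklore] -/
theorem twoGamma0_pos (d : ℕ) {a : ℝ} (ha : 0 < a) : 0 < twoGamma0 d a := by
  unfold twoGamma0; positivity

/-- **«From this representation and the bounds (2.50), (2.51) of that paper it follows that Q′_jG′_jQ′_j* ≥ 2γ₀»
— the multiplier half: `(2.75)(p′) ≥ 2γ₀` on the zone**, uniformly in `j`. [cite: Balaban1984PropagatorsII, (2.75)–(2.76) p.236] -/
theorem symbR_ge (N : ℕ) [NeZero N] (hN : 1 ≤ N) {a : ℝ} (ha : 0 < a) (s : Fin d → ℝ) (hs : s ∈ BZ d) :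
    twoGamma0 d a ≤ symbR N a s := by
  have hπ : ∀ μ, |s μ| ≤ π := fun μ => abs_le.2 ⟨hs.1 μ, hs.2 μ⟩
  have hu : 0 < (4 / π ^ 2 : ℝ) ^ d := by positivity
  have hX := Xr_ge N hN s hπ
  have hD0 : 0 ≤ DeltaXir N 0 s := DeltaXir_nonneg N 0 le_rfl s
  have hD := DeltaXir_zero_le N s hπ
  unfold twoGamma0 symbR
  rw [div_le_div_iff₀ (by positivity) (by nlinarith)]
  nlinarith [mul_le_mul hX hD hD0 (hu.le.trans hX)]

/-- the trivial upper bound `(2.75)(p′) ≤ 1/a`. [folklore] -/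
theorem symbR_le (N : ℕ) [NeZero N] {a : ℝ} (ha : 0 < a) (s : Fin d → ℝ) : symbR N a s ≤ 1 / a := by
  have hX := Xr_nonneg N s
  have hD0 : 0 ≤ DeltaXir N 0 s := DeltaXir_nonneg N 0 le_rfl s
  unfold symbR
  rcases eq_or_lt_of_le (add_nonneg (mul_nonneg ha.le hX) hD0) with h0 | hpos
  · rw [← h0, div_zero]; positivity
  · rw [div_le_div_iff₀ hpos ha]
    nlinarith

/-! ## §6  (2.75) in real form and the printed route to (2.76) -/

/-- the multiplier is continuous on the (compact) zone. [folklore] -/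
theorem continuousOn_symbQGQ (N : ℕ) [NeZero N] (hN : 1 ≤ N) {a : ℝ} (ha : 0 < a) :
    ContinuousOn (fun p : Fin d → ℝ => symbQGQ N a (ofRealVec p)) (BZ d) := by
  have hN0 : ((N : ℂ) ^ d) ≠ 0 := pow_ne_zero _ (Nat.cast_ne_zero.mpr (NeZero.ne N))
  have hc : ContinuousOn (fun p : Fin d → ℝ =>
      ((N : ℂ) ^ d)⁻¹ * ∑ j : Fin d → Fin N, Gfull N a 0 (finePt N 0 j) (ofRealVec p)) (BZ d) := by
    refine continuousOn_const.mul (continuousOn_finsetSum _ fun j _ => fun p hp => ?_)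
    exact ((differentiableAt_Gfull N hN a 0 ha le_rfl _ p hp).continuousAt.comp
      continuous_ofRealVec.continuousAt).continuousWithinAt
  refine hc.congr fun p hp => ?_
  simp only
  rw [sum_Gfull_finePt N hN a 0 p hp, ← mul_assoc, inv_mul_cancel₀ hN0, one_mul]
  simp [phaseC]

/-- the real multiplier is continuous on the zone. [folklore] -/
theorem continuousOn_symbR (N : ℕ) [NeZero N] (hN : 1 ≤ N) {a : ℝ} (ha : 0 < a) :
    ContinuousOn (symbR (d := d) N a) (BZ d) := by
  refine (Complex.continuous_re.comp_continuousOn (continuousOn_symbQGQ N hN ha)).congr fun p _ => ?_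
  simp [symbQGQ_ofReal]

/-- `p′ ↦ e^{ip′·x}` is continuous. [folklore] -/
theorem continuous_cexp_phase (x : X d) : Continuous fun p : Fin d → ℝ => cexp (I * B4ContourShift.phase p x) := by
  unfold B4ContourShift.phase
  fun_prop

/-- **B6 (2.75), REAL FORM**: `(Q'G'Q'*)(y, y') = (2π)^{−d} ∫_{[−π,π]^d} (2.75)(p′) cos(p′·(y − y′)) dp′`.
[cite: Balaban1984PropagatorsII, (2.75) p.236] -/
theorem kerQGQ_eq_integral_cos (n : ℕ) {a : ℝ} (ha : 0 < a) (y y' : X d) :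
    kerQGQ n a y y' = ((2 * π) ^ d)⁻¹ * ∫ p in BZ d, symbR (n + 1) a p * Real.cos (phase p (y - y')) := by
  have h := congrArg Complex.re (kerQGQ_eq_latticeKernel n ha y y')
  rw [Complex.ofReal_re] at h
  rw [h]
  unfold latticeKernel fourierBox integrand
  rw [Complex.smul_re, smul_eq_mul]
  congr 1
  have hint : Integrable (fun p : Fin d → ℝ => symbQGQ (n + 1) a (ofRealVec p) * cexp (I * B4ContourShift.phase p (y - y')))
      (volume.restrict (BZ d)) :=
    ((continuousOn_symbQGQ (n + 1) (by omega) ha).mul (continuous_cexp_phase _).continuousOn).integrableOn_compact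
      isCompact_BZ
  have h2 := integral_re hint
  rw [RCLike.re_to_complex] at h2
  rw [← h2]
  refine setIntegral_congr_fun measurableSet_BZ fun p _ => ?_
  rw [symbQGQ_ofReal, phaseC_eq, RCLike.re_to_complex, Complex.re_ofReal_mul, mul_comm I,
    Complex.exp_ofReal_mul_I_re]

/-- **THE FORM OF `Q'G'Q'*` IN MOMENTUM SPACE**: `Σ_{y,y′} c(y)c(y′)(Q'G'Q'*)(y,y′) = (2π)^{−d}∫ (2.75)(p′)|c̃(p′)|² dp′`
for every finitely supported `c` (window `T`). [cite: Balaban1984PropagatorsII, (2.75) p.236] -/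
theorem qGqForm_eq_integral (n : ℕ) {a : ℝ} (ha : 0 < a) (T : Finset (X d)) (c : X d → ℝ) :
    ∑ y ∈ T, c y * ∑ y' ∈ T, kerQGQ n a y y' * c y'
      = ((2 * π) ^ d)⁻¹ * ∫ p in BZ d, symbR (n + 1) a p * FTsq T c p := by
  have hcont := continuousOn_symbR (d := d) (n + 1) (by omega) ha
  have hint : ∀ z : X d, IntegrableOn (fun p => symbR (n + 1) a p * Real.cos (phase p z)) (BZ d) := fun z =>
    (hcont.mul (continuous_cos_phase z).continuousOn).integrableOn_compact isCompact_BZ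
  have hI : ∀ y y' : X d,
      IntegrableOn (fun p => symbR (n + 1) a p * (c y * c y' * Real.cos (phase p (y - y')))) (BZ d) := by
    intro y y'
    exact IntegrableOn.congr_fun ((hint (y - y')).const_mul (c y * c y')) (fun p _ => mul_left_comm _ _ _)
      measurableSet_BZ
  have hin : ∀ y y' : X d, ∫ p in BZ d, symbR (n + 1) a p * (c y * c y' * Real.cos (phase p (y - y')))
      = (c y * c y') * ∫ p in BZ d, symbR (n + 1) a p * Real.cos (phase p (y - y')) := by
    intro y y'
    rw [← integral_const_mul]
    exact integral_congr_ae (Filter.Eventually.of_forall fun p => mul_left_comm _ _ _)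
  unfold FTsq
  simp_rw [Finset.mul_sum]
  rw [integral_finsetSum _ fun y _ => integrable_finsetSum _ fun y' _ => hI y y', Finset.mul_sum]
  refine Finset.sum_congr rfl fun y _ => ?_
  rw [integral_finsetSum _ fun y' _ => hI y y', Finset.mul_sum]
  refine Finset.sum_congr rfl fun y' _ => ?_
  rw [kerQGQ_eq_integral_cos n ha, hin]
  ring

/-- **B6 (2.76) BY THE PRINTED ROUTE — «From this representation and the bounds (2.50), (2.51) of that paper it
follows that Q′_jG′_jQ′_j* ≥ 2γ₀; (2.76) γ₀ is a positive, absolute constant (a = 1).»**: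
`Σ_{y,y′} c(y)c(y′)(Q'G'Q'*)(y, y′) ≥ 2γ₀ Σ_y c(y)²` with the explicit `2γ₀ = (4/π²)^d/(a(4/π²)^d + dπ²)`, for every
`n` (every `j`).  (The tree's `B6QGQLower276.qGq_lower` is the same inequality with the variational constant
`1/(36^d(4d+a))`, obtained without (2.75).) [cite: Balaban1984PropagatorsII, (2.76) p.236] -/
theorem qGq_lower_printed (n : ℕ) {a : ℝ} (ha : 0 < a) (T : Finset (X d)) (c : X d → ℝ) :
    twoGamma0 d a * ∑ y ∈ T, c y ^ 2 ≤ ∑ y ∈ T, c y * ∑ y' ∈ T, kerQGQ n a y y' * c y' := by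
  rw [qGqForm_eq_integral n ha]
  have hcont := continuousOn_symbR (d := d) (n + 1) (by omega) ha
  have h1 : ∫ p in BZ d, twoGamma0 d a * FTsq T c p ≤ ∫ p in BZ d, symbR (n + 1) a p * FTsq T c p :=
    setIntegral_mono_on
      ((continuous_const.mul (continuous_FTsq T c)).continuousOn.integrableOn_compact isCompact_BZ)
      ((hcont.mul (continuous_FTsq T c).continuousOn).integrableOn_compact isCompact_BZ) measurableSet_BZ
      fun p hp => mul_le_mul_of_nonneg_right (symbR_ge (n + 1) (by omega) ha p hp) (FTsq_nonneg T c p)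
  rw [integral_const_mul, integral_FTsq] at h1
  have hπ : (0 : ℝ) < (2 * π) ^ d := by positivity
  calc twoGamma0 d a * ∑ y ∈ T, c y ^ 2
      = ((2 * π) ^ d)⁻¹ * (twoGamma0 d a * ((2 * π) ^ d * ∑ y ∈ T, c y ^ 2)) := by
        field_simp
    _ ≤ ((2 * π) ^ d)⁻¹ * ∫ p in BZ d, symbR (n + 1) a p * FTsq T c p :=
        mul_le_mul_of_nonneg_left h1 (by positivity)

/-- the companion upper bound `Q'G'Q'* ≤ 1/a` by the same route. [folklore] -/
theorem qGq_upper_printed (n : ℕ) {a : ℝ} (ha : 0 < a) (T : Finset (X d)) (c : X d → ℝ) :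
    ∑ y ∈ T, c y * ∑ y' ∈ T, kerQGQ n a y y' * c y' ≤ 1 / a * ∑ y ∈ T, c y ^ 2 := by
  rw [qGqForm_eq_integral n ha]
  have hcont := continuousOn_symbR (d := d) (n + 1) (by omega) ha
  have h1 : ∫ p in BZ d, symbR (n + 1) a p * FTsq T c p ≤ ∫ p in BZ d, 1 / a * FTsq T c p :=
    setIntegral_mono_on
      ((hcont.mul (continuous_FTsq T c).continuousOn).integrableOn_compact isCompact_BZ)
      ((continuous_const.mul (continuous_FTsq T c)).continuousOn.integrableOn_compact isCompact_BZ) measurableSet_BZ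
      fun p _ => mul_le_mul_of_nonneg_right (symbR_le (n + 1) ha p) (FTsq_nonneg T c p)
  rw [integral_const_mul, integral_FTsq] at h1
  have hπ : (0 : ℝ) < (2 * π) ^ d := by positivity
  calc ((2 * π) ^ d)⁻¹ * ∫ p in BZ d, symbR (n + 1) a p * FTsq T c p
      ≤ ((2 * π) ^ d)⁻¹ * (1 / a * ((2 * π) ^ d * ∑ y ∈ T, c y ^ 2)) :=
        mul_le_mul_of_nonneg_left h1 (by positivity)
    _ = 1 / a * ∑ y ∈ T, c y ^ 2 := by
        field_simp

end

end Literature.MathematicalPhysics.QuantumFieldTheory.Balaban1983to89.B6QGQFourier275Zd
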